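import Literature.MathematicalPhysics.QuantumFieldTheory.Balaban1983to89.B9SectBH1StepUParH
import Literature.MathematicalPhysics.QuantumFieldTheory.Balaban1983to89.B9SectBH2StepUParH
import Literature.MathematicalPhysics.QuantumFieldTheory.Balaban1983to89.B9SectBL2StepUParH
import Literature.MathematicalPhysics.QuantumFieldTheory.Balaban1983to89.B9SectBStepUGuardedR

/-!
# `Balaban1983to89.B9SectBStepUParHOfMembers` — T. Bałaban, *Propagators for lattice gauge theories in a background field*, Commun. Math. Phys. **99** (1985)
# 389–434 [Balaban1985BackgroundPropagators], Thm 3.4 p. 400, Sect. B pp. 400–407 (p. 407: «Thus Theorem 3.4 is proved, assuming that Theorems 3.1–3.3 hold»),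
# with (3.21) p. 394 and (3.40) p. 397: ★★★ THE ROW-13 STEP OF RECORD WITH THE TWO TRANSPORTER ROLES SEPARATED — `SectBStepUPar P f (d+1) c35 G b parA parH …`
# ASSEMBLED FROM ITS SIXTEEN MEMBERS (pub-ymgap N06 [B9]; CASCADE-K step K1, the (C) road, module F5 — the junction)

statement-level skeleton of published theorems with citation tags; proofs where landed; nothing here is a claim about the Yang–Mills mass gap

THE PRINT.  Sect. B proves Theorem 3.4 (the bounds (3.42)–(3.48) for `G′(U′U)`, `(Q′G′²Q′*)⁻¹(U′U)`, `G(U′U)` from those at `U`); its two contour families are (3.21)'s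
averaging contours (inside `Q′`, `Δ′_a`, `G′`, `G`) and (3.40)'s shortest contours (inside the Hölder quotients of (3.43), (3.45)).

WHY THIS FILE (pub-ymgap node N06 [B9]; director-ym №383 CASCADE-K: «K1 n06-c — the coded Sect.-B chain `SectBStepU … par … CinvY P f G par` at parameter `par`, its
(3.48)∕Thm 3.2∕3.3 inputs displayed per `par`»; node00-def-Y's RULING on ⚑ FLAG K1-PAR «GO `KSCUPar … parA parH`»; dag-n06-d's agreed interim (B): the knit
certificate DISPLAYS `hBK : … → SectBStepUPar … parKnitY parSymY …`).  The step of record `B9SectBStepUGuardedR.sectBStepU_of_members_g` (GUARDED `hunitA`, `hreg335P`,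
`hplaq` — the shape of record since director-ym №290) is pinned to the single transporter `par := parSymY`.  THIS FILE assembles the same sixteen members with the two
roles separated, the record's pins REPLACED BY DISPLAYED LAWS:
* §1 `stepPos_KSCUPar_of_KSC₇Par` — input transfer `KSC₇Par ⟶ KSCUPar` for any positive-input block-step (`B9SectBCodedFamiliesUParH.hin_KSCUPar_on_pos`); the six
  G-SIDE members with G′-input `KSC₇Par` over the RE-KEYED frames (`B9SectBFrameGpSwap`: `gFrame₅CodedOn ∕ h1GFrame₆CodedOn ∕ e4h2GFrame₆CodedOn ∕ l2GFrame₈CodedOn`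
  at `parA`, `.swapGp KSC₇Par`): `stepEPos ∕ stepGlobPos ∕ stepH1Pos ∕ stepE4Pos ∕ stepH2Pos ∕ stepL2Pos_KACU_framePar_on` (bond letters `OA := GAY parA parBY (GpY parA)`,
  `parB := parBY`; `hparB ∕ hLipB` by `hparB_parBY ∕ hLipB_parBY` as in the record).
* §2 ★★★ `sectBStepUPar_of_members` : `SectBStepUPar P f (d+1) c35 G b parA parH (GAY … parA parBY (GpY parA)) parBY C37 C38 (CinvY P f G parA)` — by
  `B9SectBStepWhole.sectBStepPrinted_of_posBlockSteps` on the eight G′ members of `KSCUPar parA parH` (`B9SectBCodedFamiliesUParH ∕ B9SectBH1StepUParH ∕ B9SectBH2StepUParH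
  ∕ B9SectBL2StepUParH`) and §1's six G members.  DISPLAYED (beyond `sectBStepU_of_members_g`'s structural data `hι hG1 b M₂ hrepr hcR hcL MInv aInv aW hMd mN hnbr hMr
  hb₁ C₀ hreg335P hC37 hC37G hvarB hplaq (d261, h261)`): the AVERAGING-transporter laws `hpar hunit hunitX hsym hunitA` AT `parA` (at `parA := parSymY` they are
  `parSymY_mem ∕ isUnit_deltaPrimeAY_parSymY ∕ isUnit_XY_parSymY ∕ parSymY_inv_symm ∕ Thm 3.11`; at the knit instance `parA := parKnitY` they are dag-n06-l's K2 lemmas),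
  the HÖLDER-transporter laws `hparH` + `hLip : Reg335 → HolderLipY c_Lip (parH j U) U` AT `parH`, the record's Theorem 3.2 `h32` (for `C = CY parA (GpY parA)`) and
  Theorem 3.3 `h33` READ OVER THE CODED CARRIERS for `(KSCUPar parA parH, KACU)` (the record-level Theorem 3.3 for `(kernelFamilyS … (GpY parA) parH, kernelFamilyB …)`
  enters through dag-n06-d's `B9LeafXCodedKnitUParH.thm33Printed_codedUPar` — one copy, theirs); ★★ `thm34UPar_of_members` (`B9.thm34_of_sectB`).
* §3 ★★★ `sectBStepUPar_parSymYH_of_members` — the Hölder transporter of record `parH := parSymY`: `hparH ∕ hLip` DISCHARGED (`parSymY_mem`, `hLip_parSymY`); the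
  averaging transporter `parA` and its five laws remain displayed — exactly the shape of dag-n06-d's displayed binder `hBK` at `(parA, parH) := (parKnitY, parSymY)`.

HONEST SCOPE ∕ NOT CLAIMED.  Assembly bookkeeping over landed and this road's members; every displayed law is a hypothesis; the G-sector letter is the straight one
`GAY parA parBY (GpY parA) = GAQY (QY parBY) (QsY parBY) parA (GpY parA)` (`Node00.GAQY_QY`, `rfl`) — the knit certificate's `GAQY (qKnit) (qsKnit) …` letter is NOT
served by this file (a K2-G item: the G-side frames over a generic Q-letter); count-neutral; N06 NOT discharged; nothing continuum ∕ OS ∕ mass gap ∕ Clay.  NEW file; no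
`sorry`, no `axiom`, no `instance`, no `notation`; 0 `def`.  Cell `pub-ymgap` (D-0062), seat `pub-ymgap-dag-n06-c` (gen 24), 2026-08-30; `--supports stmt-QuantumFields-27364`.
Net new unproved facts: 0.

RELATED IN THE TREE, NOT DUPLICATED (searched 2026-08-30: `rg 'sectBStepUPar_of_members|thm34UPar_of_members|stepPos_KSCUPar_of_KSC₇Par|_KACU_framePar_on' lean/Literature
lean/Summits` — 0 hits): `B9SectBStepUGuardedR` (`sectBStepU_of_members_g`, `stepGlobPos_KACU_frame_on` — the diagonal instance `parA = parH = parSymY`; its §1–§2 USED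
by shape), `B9SectBStepUOfMembersR` (`stepPos_KSCU_of_KSC`, `thm32Printed_codedU` USED), the RG frame instances (USED, re-keyed), `B9SectBCodedReadingsUParH` (`SectBStepUPar`,
`Thm34UPar`).
-/

noncomputable section

namespace Literature.MathematicalPhysics.QuantumFieldTheory.Balaban1983to89.B9SectBStepUParHOfMembers

open Literature.MathematicalPhysics.QuantumFieldTheory.Balaban1983to89.B9SectBCodedClassR (RegExtraY bg9YC)
open Literature.MathematicalPhysics.QuantumFieldTheory.Balaban1983to89.B9SectBStepUOfMembersR (thm32Printed_codedU)
open Literature.MathematicalPhysics.QuantumFieldTheory.Balaban1983to89.B9SectBCodedFamiliesUParH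
open Literature.MathematicalPhysics.QuantumFieldTheory.Balaban1983to89.B9SectBH1StepUParH (stepH1Pos_KSCUPar_on)
open Literature.MathematicalPhysics.QuantumFieldTheory.Balaban1983to89.B9SectBH2StepUParH (stepH2Pos_KSCUPar_on)
open Literature.MathematicalPhysics.QuantumFieldTheory.Balaban1983to89.B9SectBL2StepUParH (stepL2Pos_KSCUPar_on)
open B6Ineq2142KLevelV1 (β)
open B6RandomWalk (Ineq261)
open B9Thm34Ext (toB6)
open B9FromB6 (EBlock L2Block GlobBlock)
open B9PinMembersKLevelV1 (MemberY geo9Y bg9Y)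
open B9Eq360DeltaPrimeAY (AfldY)
open B9SectBGpLettersY (GVal)
open B9SectBGpFrameCodedYR (codingYx)
open B9SectBGpFrameCodedY (CplxLettersY)
open B9SectBGpReadingsYR (KSC)
open B9SectBCodedCarrier (CCfg pullK pullS thm32Printed_coded thm33Printed_coded)
open B9SectBCodedReadingsUR (KSCU KACU SectBStepU Thm34U)
open B9SectBCodedReadingsUParH (KSCUPar SectBStepUPar Thm34UPar)
open B9SectBCodedChainAnR (IsAnKY)
open B9SectBKerFrameCodedYR (CinvY)
open B9SectBStepWhole (StepPos StepEPos StepGlobPos StepL2Pos StepH1Pos StepE4Pos StepH2Pos StepKerPos StepAnalyticPos sectBStepPrinted_of_posBlockSteps)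
open B9SectBStepPosFamilyTransfer (stepPos_of_family_pos stepPos_blk_of_family_pos)
open B9RWSumsReadsNbr (nbr)
open B9SectBGClassLettersY (Reg335PlaqY CplxLettersGY VarParBY)
open B9SectBGFrameCodedYRG (gFrame₅CodedOn)
open B9SectBGStepCodedFGlobR (globBlock_KACU_prod_of_eBlock globBlock_mono_const)
open B9SectBH1GFrameCodedYRG (h1GFrame₆CodedOn)
open B9Eq340HolderLipParBYR (hLipB_parBY)
open B9Eq340HolderLipParBY (hparB_parBY)
open B9Eq340TaxiContourLocalityY (rLB rLB_nonneg)
open B9SectBE4H2GFrameCodedYRG (e4h2GFrame₆CodedOn)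
open B9SectBL2GFrameCodedY (Read377L2)
open B9SectBL2SecondOrderY (PlaqLawY)
open B9SectBL2GFrameCodedV8YRG (l2GFrame₈CodedOn)
open B9SectBL2GRead377YRG (read377L2_gFrame₅CodedOn)
open B9SectBGFrameV5 (stepEPos_of_gFrame₅)
open B9SectBH1GFrameV6 (stepH1Pos_of_h1GFrame₆)
open B9SectBE4H2GFrameV6 (stepE4Pos_of_e4h2GFrame₆ stepH2Pos_of_e4h2GFrame₆)
open B9SectBL2GFrameV8 (stepL2Pos_of_l2GFrame₈)
open B9SectBH1ProbesY (HolderLipY)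
open B9Eq340HolderLipParSymYR (hLip_parSymY)
open B9GeoNormsKLevelModelSignsV1 (modelSignsOn_geo9K)
open Node00 (SiteY BlkY FBondY IBondY CfgY SiteParY BondParY BondOpY GAY GpY XY deltaAY deltaPrimeAY parSymY parBY parSymY_inv_symm parSymY_mem kernelFamilyS kernelFamilyB)

variable {d ℓ : ℕ} {hd : 1 ≤ d + 1} {hL : Odd (ℓ + 1) ∧ 1 < ℓ + 1} {b₀ b₁ : ℝ} {Mstar : ℕ}

variable {𝔸 : Type} [NormedRing 𝔸] (P : RegExtraY d ℓ hd hL b₀ b₁ Mstar 𝔸) [NormedAlgebra ℂ 𝔸] [CompleteSpace 𝔸] [NormOneClass 𝔸] [FiniteDimensional ℝ 𝔸]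
  {J : Type} (f : J → MemberY d ℓ hd hL b₀ b₁ Mstar) [∀ x : MemberY d ℓ hd hL b₀ b₁ Mstar, Fintype (geo9Y x).Site]
  [instDS : ∀ x : MemberY d ℓ hd hL b₀ b₁ Mstar, DecidableEq (geo9Y x).Site] [instNE : ∀ x : MemberY d ℓ hd hL b₀ b₁ Mstar, Nonempty (geo9Y x).Site]
  (c35 : ℝ) (G : Subgroup 𝔸ˣ) {ι : Type} [Fintype ι] [DecidableEq ι] (b : Module.Basis ι ℝ 𝔸)
  (ιB : ∀ j : J, BlkY (f j).toKIdx → IBondY (f j).toKIdx)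
  (C38 : ∀ j : J, ℝ → CfgY 𝔸 (f j).toKIdx → AfldY 𝔸 (f j).toKIdx → Prop)
  (parA parH : ∀ j : J, SiteParY 𝔸 (f j).toKIdx) (C37 : ∀ j : J, ℝ → CfgY 𝔸 (f j).toKIdx → AfldY 𝔸 (f j).toKIdx → Prop)

/-! ## §1 The input transfer `KSC₇Par ⟶ KSCUPar` and the six G-side members with G′-input `KSC₇Par` -/

section GSide

variable (OA : ∀ j : J, BondOpY 𝔸 (f j).toKIdx) (parB : ∀ j : J, BondParY 𝔸 (f j).toKIdx) (Cinv : ∀ j : J, B9.SiteKernel (geo9Y (f j)) (bg9YC 𝔸 G P (f j)))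

omit [NormOneClass 𝔸] [FiniteDimensional ℝ 𝔸] instDS instNE [DecidableEq ι] in
/-- ★ **INPUT TRANSFER `KSC₇Par → KSCUPar` FOR ANY POSITIVE-INPUT BLOCK-STEP** (the two-transporter twin of `B9SectBStepUOfMembers.stepPos_KSCU_of_KSC`): a step stated
with the frame family `KSC₇Par parA parH` in the G′-input slot holds with the reading `KSCUPar parA parH` there (`hin_KSCUPar_on_pos`); output untouched.
[cite: Balaban1985BackgroundPropagators, Thm 3.4 p.400, Thms 3.1–3.3 (3.42)–(3.48) pp.397–399, (3.35) p.396; Balaban1984PropagatorsII, (2.51) p.232] -/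
theorem stepPos_KSCUPar_of_KSC₇Par {C : Type} {pos : C → Prop}
    {Out : C → ∀ j : J, (codingYx P G (f j) (C37 j) (C38 j)).bg.Cfg → ℝ → Prop}
    (hι : ∀ (j : J) (s : BlkY (f j).toKIdx), β (f j).toKIdx.hN (f j).toKIdx.D (f j).toKIdx.hk (ιB j s) = s)
    (hG1 : ∀ u : 𝔸ˣ, u ∈ G → ‖(u : 𝔸)‖ ≤ 1) {M₂ : ℝ} (hM₂ : 0 ≤ M₂) (hrepr : ∀ (v : 𝔸) (j : ι), |b.repr v j| ≤ M₂ * ‖v‖) (dC : ℕ)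
    (h : StepPos dC c35 (fun j => geo9Y (f j)) (fun j => (codingYx P G (f j) (C37 j) (C38 j)).bg) (fun j => KSC₇Par P G (f j) (parA j) (parH j) (C37 j) (C38 j))
      (fun j => KACU P G (f j) (OA j) (parB j) (C37 j) (C38 j)) (fun j => pullS (codingYx P G (f j) (C37 j) (C38 j)) (Cinv j)) C pos Out) :
    StepPos dC c35 (fun j => geo9Y (f j)) (fun j => (codingYx P G (f j) (C37 j) (C38 j)).bg) (fun j => KSCUPar P G (f j) (parA j) (parH j) (C37 j) (C38 j))
      (fun j => KACU P G (f j) (OA j) (parB j) (C37 j) (C38 j)) (fun j => pullS (codingYx P G (f j) (C37 j) (C38 j)) (Cinv j)) C pos Out :=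
  stepPos_of_family_pos dC c35 (fun j => geo9Y (f j)) (fun j => (codingYx P G (f j) (C37 j) (C38 j)).bg) (fun j => KSC₇Par P G (f j) (parA j) (parH j) (C37 j) (C38 j))
    (fun j => KSCUPar P G (f j) (parA j) (parH j) (C37 j) (C38 j)) (fun j => KACU P G (f j) (OA j) (parB j) (C37 j) (C38 j))
    (fun j => KACU P G (f j) (OA j) (parB j) (C37 j) (C38 j)) (fun j => pullS (codingYx P G (f j) (C37 j) (C38 j)) (Cinv j))
    (hin_KSCUPar_on_pos P f c35 G parA parH OA parB b ιB C37 C38 Cinv hι hG1 hM₂ hrepr dC)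
    (fun c hc a ha => ⟨0, 1, a, c, one_pos, ha, le_rfl, hc, fun _ _ _ _ _ _ _ _ _ _ h' => h'⟩) h

/-- ★ **THE (3.42) MEMBER OF THE BOND FAMILY `KACU` THROUGH THE RE-KEYED G FRAME** (G′-input `KSC₇Par parA parH`): `stepEPos_of_gFrame₅` on the record's guarded frame
`B9SectBGFrameCodedYRG.gFrame₅CodedOn` AT `parA` (bond transporter `parBY`, `hparB := hparB_parBY`) re-keyed by `GFrame₅.swapGp`.
[cite: Balaban1985BackgroundPropagators, Thm 3.4 p.400, Thm 3.3 p.399, (3.42) p.397, (3.82)–(3.86) p.407; Balaban1984PropagatorsII, Lemma 2.1 p.234, (2.51) p.232] -/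
theorem stepEPos_KACU_framePar_on (hι : ∀ (j : J) (s : BlkY (f j).toKIdx), β (f j).toKIdx.hN (f j).toKIdx.D (f j).toKIdx.hk (ιB j s) = s)
    (hG1 : ∀ u : 𝔸ˣ, u ∈ G → ‖(u : 𝔸)‖ ≤ 1) (hpar : ∀ j (U : CfgY 𝔸 (f j).toKIdx), GVal G (f j).toKIdx U → ∀ z w, parA j U z w ∈ G)
    (hunit : ∀ j (U : CfgY 𝔸 (f j).toKIdx), GVal G (f j).toKIdx U → IsUnit (deltaPrimeAY (f j).toKIdx (parA j) U))
    (M₂ : ℝ) (hM₂ : 0 ≤ M₂) (hrepr : ∀ (v : 𝔸) (j : ι), |b.repr v j| ≤ M₂ * ‖v‖) (hcR : 0 < M₂ * ∑ j, ‖b j‖)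
    (Cq : ℝ) (hCq : 0 ≤ Cq) (hC37 : ∀ j β' U a, C37 j β' U a → GVal G (f j).toKIdx U ∧ CplxLettersY G (f j) (parA j) (ιB j) Cq β' U a)
    (MInv aInv aW : ℝ) (hMInv : 0 < MInv) (haInv : 0 < aInv) (haW : 0 < aW)
    (hunitX : ∀ j (U : CfgY 𝔸 (f j).toKIdx), GVal G (f j).toKIdx U → IsUnit (XY (f j).toKIdx (parA j) (GpY (f j).toKIdx (parA j)) U))
    (hsym : ∀ j (U : CfgY 𝔸 (f j).toKIdx) (z w : SiteY (f j).toKIdx), parA j U z w = (parA j U w z)⁻¹)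
    (hunitA : ∀ j (α₀ : ℝ) (U : CfgY 𝔸 (f j).toKIdx), MInv ≤ (geo9Y (f j)).M → 0 < α₀ → (geo9Y (f j)).M * α₀ ≤ aInv →
      (bg9YC 𝔸 G P (f j)).Reg335 c35 α₀ U →
      IsUnit (deltaAY (f j).toKIdx (parA j) (parBY (f j).toKIdx) (GpY (f j).toKIdx (parA j)) U)) (hb₁ : 0 ≤ b₁)
    (C₀ : ℝ) (hC₀ : 0 ≤ C₀)
    (hreg335P : ∀ j (α₀ : ℝ) (U : CfgY 𝔸 (f j).toKIdx), MInv ≤ (geo9Y (f j)).M → 0 < α₀ → (geo9Y (f j)).M * α₀ ≤ aInv →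
      (bg9YC 𝔸 G P (f j)).Reg335 c35 α₀ U → Reg335PlaqY G (f j) (ιB j) C₀ U)
    (hC37G : ∀ j β' U a, C37 j β' U a → CplxLettersGY G (f j) (ιB j) β' U a)
    (cVar : ℝ) (hcVar : 0 ≤ cVar) (hvarB : ∀ j β' U a, C37 j β' U a → VarParBY (f j).toKIdx (parBY (f j).toKIdx) cVar β' U a)
    (hMd : 2 * ((d : ℝ) + 1) < MInv) (mN : ℕ) (hnbr : ∀ (j : J) (y' : IBondY (f j).toKIdx), (nbr (geo9Y (f j)) (2 * ((d : ℝ) + 1)) y').card ≤ mN)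
    (d261 : ℝ → ℕ)
    (h261 : ∀ (j : J) (δ α : ℝ), 0 < δ → δ ≤ 1 → 9 / 5000 ≤ α → α < 1 →
      (gFrame₅CodedOn P f c35 G parA (fun j => parBY (f j).toKIdx) b ιB C37 C38 hι hG1 hpar hunit M₂ hM₂ hrepr hcR Cq hCq hC37 MInv aInv aW hMInv haInv haW
        hunitX hsym hunitA (hparB_parBY f G) hb₁ C₀ hC₀ hreg335P hC37G cVar hcVar hvarB hMd mN hnbr).M261 δ ≤ (geo9Y (f j)).M →
      Ineq261 (d261 δ) (toB6 (geo9Y (f j)) 0 True) δ α) :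
    StepEPos (d + 1) c35 (fun j => geo9Y (f j)) (fun j => (codingYx P G (f j) (C37 j) (C38 j)).bg) (fun j => KSC₇Par P G (f j) (parA j) (parH j) (C37 j) (C38 j))
      (fun j => KACU P G (f j) (GAY (f j).toKIdx (parA j) (parBY (f j).toKIdx) (GpY (f j).toKIdx (parA j))) (parBY (f j).toKIdx) (C37 j) (C38 j))
      (fun j => pullS (codingYx P G (f j) (C37 j) (C38 j)) (CinvY P f G parA j))
      (fun j => KACU P G (f j) (GAY (f j).toKIdx (parA j) (parBY (f j).toKIdx) (GpY (f j).toKIdx (parA j))) (parBY (f j).toKIdx) (C37 j) (C38 j)) :=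
  stepEPos_of_gFrame₅ (F := (gFrame₅CodedOn P f c35 G parA (fun j => parBY (f j).toKIdx) b ιB C37 C38 hι hG1 hpar hunit M₂ hM₂ hrepr hcR Cq hCq hC37 MInv aInv aW hMInv haInv haW hunitX hsym hunitA
        (hparB_parBY f G) hb₁ C₀ hC₀ hreg335P hC37G cVar hcVar hvarB hMd mN hnbr).swapGp (fun j => KSC₇Par P G (f j) (parA j) (parH j) (C37 j) (C38 j))
      (fun j _ _ c => eBlock_KSC₇Par_iff P G (f j) (parA j) (parH j) (C37 j) (C38 j) c)) d261 h261

/-- ★ **THE (3.47) MEMBER OF `KACU` THROUGH THE RE-KEYED G FRAME**: §1's (3.42) step followed at every coded product by dag-n06-c's «(3.42) block ⟹ (3.47) block»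
(`globBlock_KACU_prod_of_eBlock`, [4] Lemma 2.1) — `B9SectBStepUGuardedR.stepGlobPos_KACU_frame_on`'s proof verbatim.
[cite: Balaban1985BackgroundPropagators, Thm 3.4 p.400, (3.47) p.398, (3.82)–(3.86) p.407; Balaban1984PropagatorsII, Lemma 2.1 p.234, (2.51) p.232] -/
theorem stepGlobPos_KACU_framePar_on (hι : ∀ (j : J) (s : BlkY (f j).toKIdx), β (f j).toKIdx.hN (f j).toKIdx.D (f j).toKIdx.hk (ιB j s) = s)
    (hG1 : ∀ u : 𝔸ˣ, u ∈ G → ‖(u : 𝔸)‖ ≤ 1) (hpar : ∀ j (U : CfgY 𝔸 (f j).toKIdx), GVal G (f j).toKIdx U → ∀ z w, parA j U z w ∈ G)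
    (hunit : ∀ j (U : CfgY 𝔸 (f j).toKIdx), GVal G (f j).toKIdx U → IsUnit (deltaPrimeAY (f j).toKIdx (parA j) U))
    (M₂ : ℝ) (hM₂ : 0 ≤ M₂) (hrepr : ∀ (v : 𝔸) (j : ι), |b.repr v j| ≤ M₂ * ‖v‖) (hcR : 0 < M₂ * ∑ j, ‖b j‖)
    (Cq : ℝ) (hCq : 0 ≤ Cq) (hC37 : ∀ j β' U a, C37 j β' U a → GVal G (f j).toKIdx U ∧ CplxLettersY G (f j) (parA j) (ιB j) Cq β' U a)
    (MInv aInv aW : ℝ) (hMInv : 0 < MInv) (haInv : 0 < aInv) (haW : 0 < aW)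
    (hunitX : ∀ j (U : CfgY 𝔸 (f j).toKIdx), GVal G (f j).toKIdx U → IsUnit (XY (f j).toKIdx (parA j) (GpY (f j).toKIdx (parA j)) U))
    (hsym : ∀ j (U : CfgY 𝔸 (f j).toKIdx) (z w : SiteY (f j).toKIdx), parA j U z w = (parA j U w z)⁻¹)
    (hunitA : ∀ j (α₀ : ℝ) (U : CfgY 𝔸 (f j).toKIdx), MInv ≤ (geo9Y (f j)).M → 0 < α₀ → (geo9Y (f j)).M * α₀ ≤ aInv →
      (bg9YC 𝔸 G P (f j)).Reg335 c35 α₀ U →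
      IsUnit (deltaAY (f j).toKIdx (parA j) (parBY (f j).toKIdx) (GpY (f j).toKIdx (parA j)) U)) (hb₁ : 0 ≤ b₁)
    (C₀ : ℝ) (hC₀ : 0 ≤ C₀)
    (hreg335P : ∀ j (α₀ : ℝ) (U : CfgY 𝔸 (f j).toKIdx), MInv ≤ (geo9Y (f j)).M → 0 < α₀ → (geo9Y (f j)).M * α₀ ≤ aInv →
      (bg9YC 𝔸 G P (f j)).Reg335 c35 α₀ U → Reg335PlaqY G (f j) (ιB j) C₀ U)
    (hC37G : ∀ j β' U a, C37 j β' U a → CplxLettersGY G (f j) (ιB j) β' U a)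
    (cVar : ℝ) (hcVar : 0 ≤ cVar) (hvarB : ∀ j β' U a, C37 j β' U a → VarParBY (f j).toKIdx (parBY (f j).toKIdx) cVar β' U a)
    (hMd : 2 * ((d : ℝ) + 1) < MInv) (mN : ℕ) (hnbr : ∀ (j : J) (y' : IBondY (f j).toKIdx), (nbr (geo9Y (f j)) (2 * ((d : ℝ) + 1)) y').card ≤ mN)
    (d261 : ℝ → ℕ)
    (h261 : ∀ (j : J) (δ α : ℝ), 0 < δ → δ ≤ 1 → 9 / 5000 ≤ α → α < 1 →
      (gFrame₅CodedOn P f c35 G parA (fun j => parBY (f j).toKIdx) b ιB C37 C38 hι hG1 hpar hunit M₂ hM₂ hrepr hcR Cq hCq hC37 MInv aInv aW hMInv haInv haW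
        hunitX hsym hunitA (hparB_parBY f G) hb₁ C₀ hC₀ hreg335P hC37G cVar hcVar hvarB hMd mN hnbr).M261 δ ≤ (geo9Y (f j)).M →
      Ineq261 (d261 δ) (toB6 (geo9Y (f j)) 0 True) δ α) :
    StepGlobPos (d + 1) c35 (fun j => geo9Y (f j)) (fun j => (codingYx P G (f j) (C37 j) (C38 j)).bg) (fun j => KSC₇Par P G (f j) (parA j) (parH j) (C37 j) (C38 j))
      (fun j => KACU P G (f j) (GAY (f j).toKIdx (parA j) (parBY (f j).toKIdx) (GpY (f j).toKIdx (parA j))) (parBY (f j).toKIdx) (C37 j) (C38 j))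
      (fun j => pullS (codingYx P G (f j) (C37 j) (C38 j)) (CinvY P f G parA j))
      (fun j => KACU P G (f j) (GAY (f j).toKIdx (parA j) (parBY (f j).toKIdx) (GpY (f j).toKIdx (parA j))) (parBY (f j).toKIdx) (C37 j) (C38 j)) := by
  refine stepPos_blk_of_family_pos (d + 1) c35 (fun j => geo9Y (f j)) (fun j => (codingYx P G (f j) (C37 j) (C38 j)).bg)
    (fun j => KSC₇Par P G (f j) (parA j) (parH j) (C37 j) (C38 j)) (fun j => KSC₇Par P G (f j) (parA j) (parH j) (C37 j) (C38 j))
    (fun j => KACU P G (f j) (GAY (f j).toKIdx (parA j) (parBY (f j).toKIdx) (GpY (f j).toKIdx (parA j))) (parBY (f j).toKIdx) (C37 j) (C38 j))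
    (fun j => KACU P G (f j) (GAY (f j).toKIdx (parA j) (parBY (f j).toKIdx) (GpY (f j).toKIdx (parA j))) (parBY (f j).toKIdx) (C37 j) (C38 j))
    (fun j => pullS (codingYx P G (f j) (C37 j) (C38 j)) (CinvY P f G parA j))
    (C₁ := ℝ × ℝ) (C₂ := ℝ) (pos₁ := fun c => 0 < c.1 ∧ 0 < c.2) (pos₂ := fun c => 0 < c)
    (Blk₁ := fun c j W => EBlock (KACU P G (f j) (GAY (f j).toKIdx (parA j) (parBY (f j).toKIdx) (GpY (f j).toKIdx (parA j))) (parBY (f j).toKIdx) (C37 j) (C38 j)) c.1 c.2 W)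
    (Blk₂ := fun c j W => GlobBlock (KACU P G (f j) (GAY (f j).toKIdx (parA j) (parBY (f j).toKIdx) (GpY (f j).toKIdx (parA j))) (parBY (f j).toKIdx) (C37 j) (C38 j)) c W)
    (fun B₀ δ₀ Bβ Bε Bεβ B₁ δ₁ hB₀ hδ₀ hB₁ hδ₁ =>
      ⟨0, 1, B₀, δ₀, Bβ, Bε, Bεβ, B₁, δ₁, one_pos, hB₀, hδ₀, hB₁, hδ₁, fun _ _ _ _ _ _ _ hT => hT⟩)
    (fun c hc a ha => ?_)
    (stepEPos_KACU_framePar_on P f c35 G b ιB C38 parA parH C37 hι hG1 hpar hunit M₂ hM₂ hrepr hcR Cq hCq hC37 MInv aInv aW hMInv haInv haW hunitX hsym hunitA hb₁ C₀ hC₀ hreg335P hC37G cVar hcVar hvarB hMd mN hnbr d261 h261)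
  obtain ⟨Mg, Cg, hCg, H⟩ := globBlock_KACU_prod_of_eBlock P (𝔸 := 𝔸) (d := d) (ℓ := ℓ) (hd := hd) (hL := hL) (b₀ := b₀) (b₁ := b₁) (Mstar := Mstar) G hc.2
  refine ⟨Mg, 1, a, c.1 * (Cg + 1), one_pos, ha, le_rfl, mul_pos hc.1 (by linarith), ?_⟩
  intro j hM α₀ hα₀ _ W hreg α₁ _ _ W' h37 hE
  obtain ⟨U, rfl, -⟩ := (codingYx P G (f j) (C37 j) (C38 j)).exists_of_bg_Reg335 hreg
  obtain ⟨U', a', hcU, rfl, -⟩ := (codingYx P G (f j) (C37 j) (C38 j)).exists_of_bg_Cplx337 h37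
  cases hcU
  have hG := H (f j) (ιB j) (hι j) hM (GAY (f j).toKIdx (parA j) (parBY (f j).toKIdx) (GpY (f j).toKIdx (parA j))) (parBY (f j).toKIdx) (C37 j) (C38 j) U a' c.1 hc.1.le hE
  exact globBlock_mono_const P G (f j) _ (parBY (f j).toKIdx) (C37 j) (C38 j) hG (mul_le_mul_of_nonneg_left (by linarith) hc.1.le)

set_option maxHeartbeats 1600000 in
/-- ★ **THE (3.43) MEMBER OF `KACU` THROUGH THE RE-KEYED G FRAME** (bond transporter `parBY`: `hparB := hparB_parBY`, `hLipB := hLipB_parBY`, `c_LipB = d+1`, `r_L = rLB`):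
`stepH1Pos_of_h1GFrame₆` on `B9SectBH1GFrameCodedYRG.h1GFrame₆CodedOn` AT `parA` re-keyed by `H1GFrame₆.swapGp`.
[cite: Balaban1985BackgroundPropagators, Thm 3.4 p.400, Thm 3.3 p.399, (3.43) p.398, (3.40) p.397; Balaban1984PropagatorsII, Lemma 2.1 p.234, (2.51)–(2.52) p.232] -/
theorem stepH1Pos_KACU_framePar_on (hι : ∀ (j : J) (s : BlkY (f j).toKIdx), β (f j).toKIdx.hN (f j).toKIdx.D (f j).toKIdx.hk (ιB j s) = s)
    (hG1 : ∀ u : 𝔸ˣ, u ∈ G → ‖(u : 𝔸)‖ ≤ 1) (hpar : ∀ j (U : CfgY 𝔸 (f j).toKIdx), GVal G (f j).toKIdx U → ∀ z w, parA j U z w ∈ G)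
    (hunit : ∀ j (U : CfgY 𝔸 (f j).toKIdx), GVal G (f j).toKIdx U → IsUnit (deltaPrimeAY (f j).toKIdx (parA j) U))
    (M₂ : ℝ) (hM₂ : 0 ≤ M₂) (hrepr : ∀ (v : 𝔸) (j : ι), |b.repr v j| ≤ M₂ * ‖v‖) (hcR : 0 < M₂ * ∑ j, ‖b j‖)
    (Cq : ℝ) (hCq : 0 ≤ Cq) (hC37 : ∀ j β' U a, C37 j β' U a → GVal G (f j).toKIdx U ∧ CplxLettersY G (f j) (parA j) (ιB j) Cq β' U a)
    (MInv aInv aW : ℝ) (hMInv : 0 < MInv) (haInv : 0 < aInv) (haW : 0 < aW)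
    (hunitX : ∀ j (U : CfgY 𝔸 (f j).toKIdx), GVal G (f j).toKIdx U → IsUnit (XY (f j).toKIdx (parA j) (GpY (f j).toKIdx (parA j)) U))
    (hsym : ∀ j (U : CfgY 𝔸 (f j).toKIdx) (z w : SiteY (f j).toKIdx), parA j U z w = (parA j U w z)⁻¹)
    (hunitA : ∀ j (α₀ : ℝ) (U : CfgY 𝔸 (f j).toKIdx), MInv ≤ (geo9Y (f j)).M → 0 < α₀ → (geo9Y (f j)).M * α₀ ≤ aInv →
      (bg9YC 𝔸 G P (f j)).Reg335 c35 α₀ U →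
      IsUnit (deltaAY (f j).toKIdx (parA j) (parBY (f j).toKIdx) (GpY (f j).toKIdx (parA j)) U)) (hb₁ : 0 ≤ b₁)
    (C₀ : ℝ) (hC₀ : 0 ≤ C₀)
    (hreg335P : ∀ j (α₀ : ℝ) (U : CfgY 𝔸 (f j).toKIdx), MInv ≤ (geo9Y (f j)).M → 0 < α₀ → (geo9Y (f j)).M * α₀ ≤ aInv →
      (bg9YC 𝔸 G P (f j)).Reg335 c35 α₀ U → Reg335PlaqY G (f j) (ιB j) C₀ U)
    (hC37G : ∀ j β' U a, C37 j β' U a → CplxLettersGY G (f j) (ιB j) β' U a)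
    (cVar : ℝ) (hcVar : 0 ≤ cVar) (hvarB : ∀ j β' U a, C37 j β' U a → VarParBY (f j).toKIdx (parBY (f j).toKIdx) cVar β' U a)
    (hMd : 2 * ((d : ℝ) + 1) < MInv) (mN : ℕ) (hnbr : ∀ (j : J) (y' : IBondY (f j).toKIdx), (nbr (geo9Y (f j)) (2 * ((d : ℝ) + 1)) y').card ≤ mN)
    (hMr : rLB d ℓ + 1 < MInv) (d261 : ℝ → ℕ)
    (h261 : ∀ (j : J) (δ α : ℝ), 0 < δ → δ ≤ 1 → 9 / 5000 ≤ α → α < 1 →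
      (gFrame₅CodedOn P f c35 G parA (fun j => parBY (f j).toKIdx) b ιB C37 C38 hι hG1 hpar hunit M₂ hM₂ hrepr hcR Cq hCq hC37 MInv aInv aW hMInv haInv haW
        hunitX hsym hunitA (hparB_parBY f G) hb₁ C₀ hC₀ hreg335P hC37G cVar hcVar hvarB hMd mN hnbr).M261 δ ≤ (geo9Y (f j)).M →
      Ineq261 (d261 δ) (toB6 (geo9Y (f j)) 0 True) δ α) :
    StepH1Pos (d + 1) c35 (fun j => geo9Y (f j)) (fun j => (codingYx P G (f j) (C37 j) (C38 j)).bg) (fun j => KSC₇Par P G (f j) (parA j) (parH j) (C37 j) (C38 j))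
      (fun j => KACU P G (f j) (GAY (f j).toKIdx (parA j) (parBY (f j).toKIdx) (GpY (f j).toKIdx (parA j))) (parBY (f j).toKIdx) (C37 j) (C38 j))
      (fun j => pullS (codingYx P G (f j) (C37 j) (C38 j)) (CinvY P f G parA j))
      (fun j => KACU P G (f j) (GAY (f j).toKIdx (parA j) (parBY (f j).toKIdx) (GpY (f j).toKIdx (parA j))) (parBY (f j).toKIdx) (C37 j) (C38 j)) :=
  stepH1Pos_of_h1GFrame₆ (F := (h1GFrame₆CodedOn P f c35 G parA (fun j => parBY (f j).toKIdx) b ιB C37 C38 hι hG1 hpar hunit M₂ hM₂ hrepr hcR Cq hCq hC37 MInv aInv aW hMInv haInv haW hunitX hsym hunitA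
        (hparB_parBY f G) hb₁ C₀ hC₀ hreg335P hC37G cVar hcVar hvarB hMd mN hnbr (by positivity : (0 : ℝ) ≤ (d : ℝ) + 1)
        (rLB_nonneg d ℓ) (hLipB_parBY P f c35 G hG1) hMr).swapGp (fun j => KSC₇Par P G (f j) (parA j) (parH j) (C37 j) (C38 j))
      (fun j _ _ c => eBlock_KSC₇Par_iff P G (f j) (parA j) (parH j) (C37 j) (C38 j) c)) d261 h261

/-- ★ **THE (3.44) MEMBER OF `KACU` THROUGH THE RE-KEYED G FRAME**: `stepE4Pos_of_e4h2GFrame₆` on `B9SectBE4H2GFrameCodedYRG.e4h2GFrame₆CodedOn` AT `parA` re-keyed by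
`E4H2GFrame₆.swapGp`. [cite: Balaban1985BackgroundPropagators, Thm 3.4 p.400, Thm 3.3 p.399, (3.44) p.398, (3.82)–(3.86) p.407; Balaban1984PropagatorsII, Lemma 2.1 p.234] -/
theorem stepE4Pos_KACU_framePar_on (hι : ∀ (j : J) (s : BlkY (f j).toKIdx), β (f j).toKIdx.hN (f j).toKIdx.D (f j).toKIdx.hk (ιB j s) = s)
    (hG1 : ∀ u : 𝔸ˣ, u ∈ G → ‖(u : 𝔸)‖ ≤ 1) (hpar : ∀ j (U : CfgY 𝔸 (f j).toKIdx), GVal G (f j).toKIdx U → ∀ z w, parA j U z w ∈ G)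
    (hunit : ∀ j (U : CfgY 𝔸 (f j).toKIdx), GVal G (f j).toKIdx U → IsUnit (deltaPrimeAY (f j).toKIdx (parA j) U))
    (M₂ : ℝ) (hM₂ : 0 ≤ M₂) (hrepr : ∀ (v : 𝔸) (j : ι), |b.repr v j| ≤ M₂ * ‖v‖) (hcR : 0 < M₂ * ∑ j, ‖b j‖)
    (Cq : ℝ) (hCq : 0 ≤ Cq) (hC37 : ∀ j β' U a, C37 j β' U a → GVal G (f j).toKIdx U ∧ CplxLettersY G (f j) (parA j) (ιB j) Cq β' U a)
    (MInv aInv aW : ℝ) (hMInv : 0 < MInv) (haInv : 0 < aInv) (haW : 0 < aW)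
    (hunitX : ∀ j (U : CfgY 𝔸 (f j).toKIdx), GVal G (f j).toKIdx U → IsUnit (XY (f j).toKIdx (parA j) (GpY (f j).toKIdx (parA j)) U))
    (hsym : ∀ j (U : CfgY 𝔸 (f j).toKIdx) (z w : SiteY (f j).toKIdx), parA j U z w = (parA j U w z)⁻¹)
    (hunitA : ∀ j (α₀ : ℝ) (U : CfgY 𝔸 (f j).toKIdx), MInv ≤ (geo9Y (f j)).M → 0 < α₀ → (geo9Y (f j)).M * α₀ ≤ aInv →
      (bg9YC 𝔸 G P (f j)).Reg335 c35 α₀ U →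
      IsUnit (deltaAY (f j).toKIdx (parA j) (parBY (f j).toKIdx) (GpY (f j).toKIdx (parA j)) U)) (hb₁ : 0 ≤ b₁)
    (C₀ : ℝ) (hC₀ : 0 ≤ C₀)
    (hreg335P : ∀ j (α₀ : ℝ) (U : CfgY 𝔸 (f j).toKIdx), MInv ≤ (geo9Y (f j)).M → 0 < α₀ → (geo9Y (f j)).M * α₀ ≤ aInv →
      (bg9YC 𝔸 G P (f j)).Reg335 c35 α₀ U → Reg335PlaqY G (f j) (ιB j) C₀ U)
    (hC37G : ∀ j β' U a, C37 j β' U a → CplxLettersGY G (f j) (ιB j) β' U a)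
    (cVar : ℝ) (hcVar : 0 ≤ cVar) (hvarB : ∀ j β' U a, C37 j β' U a → VarParBY (f j).toKIdx (parBY (f j).toKIdx) cVar β' U a)
    (hMd : 2 * ((d : ℝ) + 1) < MInv) (mN : ℕ) (hnbr : ∀ (j : J) (y' : IBondY (f j).toKIdx), (nbr (geo9Y (f j)) (2 * ((d : ℝ) + 1)) y').card ≤ mN)
    (d261 : ℝ → ℕ)
    (h261 : ∀ (j : J) (δ α : ℝ), 0 < δ → δ ≤ 1 → 9 / 5000 ≤ α → α < 1 →
      (gFrame₅CodedOn P f c35 G parA (fun j => parBY (f j).toKIdx) b ιB C37 C38 hι hG1 hpar hunit M₂ hM₂ hrepr hcR Cq hCq hC37 MInv aInv aW hMInv haInv haW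
        hunitX hsym hunitA (hparB_parBY f G) hb₁ C₀ hC₀ hreg335P hC37G cVar hcVar hvarB hMd mN hnbr).M261 δ ≤ (geo9Y (f j)).M →
      Ineq261 (d261 δ) (toB6 (geo9Y (f j)) 0 True) δ α) :
    StepE4Pos (d + 1) c35 (fun j => geo9Y (f j)) (fun j => (codingYx P G (f j) (C37 j) (C38 j)).bg) (fun j => KSC₇Par P G (f j) (parA j) (parH j) (C37 j) (C38 j))
      (fun j => KACU P G (f j) (GAY (f j).toKIdx (parA j) (parBY (f j).toKIdx) (GpY (f j).toKIdx (parA j))) (parBY (f j).toKIdx) (C37 j) (C38 j))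
      (fun j => pullS (codingYx P G (f j) (C37 j) (C38 j)) (CinvY P f G parA j))
      (fun j => KACU P G (f j) (GAY (f j).toKIdx (parA j) (parBY (f j).toKIdx) (GpY (f j).toKIdx (parA j))) (parBY (f j).toKIdx) (C37 j) (C38 j)) :=
  stepE4Pos_of_e4h2GFrame₆ (F := (e4h2GFrame₆CodedOn P f c35 G parA (fun j => parBY (f j).toKIdx) b ιB C37 C38 hι hG1 hpar hunit M₂ hM₂ hrepr hcR Cq hCq hC37 MInv aInv aW hMInv haInv haW hunitX hsym hunitA
        (hparB_parBY f G) hb₁ C₀ hC₀ hreg335P hC37G cVar hcVar hvarB hMd mN hnbr).swapGp (fun j => KSC₇Par P G (f j) (parA j) (parH j) (C37 j) (C38 j))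
      (fun j _ _ c => eBlock_KSC₇Par_iff P G (f j) (parA j) (parH j) (C37 j) (C38 j) c)) d261 h261

/-- ★ **THE (3.45) MEMBER OF `KACU` THROUGH THE RE-KEYED G FRAME**: `stepH2Pos_of_e4h2GFrame₆` on the same re-keyed frame.
[cite: Balaban1985BackgroundPropagators, Thm 3.4 p.400, Thm 3.3 p.399, (3.45) p.398, (3.82)–(3.86) p.407; Balaban1984PropagatorsII, Lemma 2.1 p.234] -/
theorem stepH2Pos_KACU_framePar_on (hι : ∀ (j : J) (s : BlkY (f j).toKIdx), β (f j).toKIdx.hN (f j).toKIdx.D (f j).toKIdx.hk (ιB j s) = s)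
    (hG1 : ∀ u : 𝔸ˣ, u ∈ G → ‖(u : 𝔸)‖ ≤ 1) (hpar : ∀ j (U : CfgY 𝔸 (f j).toKIdx), GVal G (f j).toKIdx U → ∀ z w, parA j U z w ∈ G)
    (hunit : ∀ j (U : CfgY 𝔸 (f j).toKIdx), GVal G (f j).toKIdx U → IsUnit (deltaPrimeAY (f j).toKIdx (parA j) U))
    (M₂ : ℝ) (hM₂ : 0 ≤ M₂) (hrepr : ∀ (v : 𝔸) (j : ι), |b.repr v j| ≤ M₂ * ‖v‖) (hcR : 0 < M₂ * ∑ j, ‖b j‖)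
    (Cq : ℝ) (hCq : 0 ≤ Cq) (hC37 : ∀ j β' U a, C37 j β' U a → GVal G (f j).toKIdx U ∧ CplxLettersY G (f j) (parA j) (ιB j) Cq β' U a)
    (MInv aInv aW : ℝ) (hMInv : 0 < MInv) (haInv : 0 < aInv) (haW : 0 < aW)
    (hunitX : ∀ j (U : CfgY 𝔸 (f j).toKIdx), GVal G (f j).toKIdx U → IsUnit (XY (f j).toKIdx (parA j) (GpY (f j).toKIdx (parA j)) U))
    (hsym : ∀ j (U : CfgY 𝔸 (f j).toKIdx) (z w : SiteY (f j).toKIdx), parA j U z w = (parA j U w z)⁻¹)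
    (hunitA : ∀ j (α₀ : ℝ) (U : CfgY 𝔸 (f j).toKIdx), MInv ≤ (geo9Y (f j)).M → 0 < α₀ → (geo9Y (f j)).M * α₀ ≤ aInv →
      (bg9YC 𝔸 G P (f j)).Reg335 c35 α₀ U →
      IsUnit (deltaAY (f j).toKIdx (parA j) (parBY (f j).toKIdx) (GpY (f j).toKIdx (parA j)) U)) (hb₁ : 0 ≤ b₁)
    (C₀ : ℝ) (hC₀ : 0 ≤ C₀)
    (hreg335P : ∀ j (α₀ : ℝ) (U : CfgY 𝔸 (f j).toKIdx), MInv ≤ (geo9Y (f j)).M → 0 < α₀ → (geo9Y (f j)).M * α₀ ≤ aInv →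
      (bg9YC 𝔸 G P (f j)).Reg335 c35 α₀ U → Reg335PlaqY G (f j) (ιB j) C₀ U)
    (hC37G : ∀ j β' U a, C37 j β' U a → CplxLettersGY G (f j) (ιB j) β' U a)
    (cVar : ℝ) (hcVar : 0 ≤ cVar) (hvarB : ∀ j β' U a, C37 j β' U a → VarParBY (f j).toKIdx (parBY (f j).toKIdx) cVar β' U a)
    (hMd : 2 * ((d : ℝ) + 1) < MInv) (mN : ℕ) (hnbr : ∀ (j : J) (y' : IBondY (f j).toKIdx), (nbr (geo9Y (f j)) (2 * ((d : ℝ) + 1)) y').card ≤ mN)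
    (d261 : ℝ → ℕ)
    (h261 : ∀ (j : J) (δ α : ℝ), 0 < δ → δ ≤ 1 → 9 / 5000 ≤ α → α < 1 →
      (gFrame₅CodedOn P f c35 G parA (fun j => parBY (f j).toKIdx) b ιB C37 C38 hι hG1 hpar hunit M₂ hM₂ hrepr hcR Cq hCq hC37 MInv aInv aW hMInv haInv haW
        hunitX hsym hunitA (hparB_parBY f G) hb₁ C₀ hC₀ hreg335P hC37G cVar hcVar hvarB hMd mN hnbr).M261 δ ≤ (geo9Y (f j)).M →
      Ineq261 (d261 δ) (toB6 (geo9Y (f j)) 0 True) δ α) :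
    StepH2Pos (d + 1) c35 (fun j => geo9Y (f j)) (fun j => (codingYx P G (f j) (C37 j) (C38 j)).bg) (fun j => KSC₇Par P G (f j) (parA j) (parH j) (C37 j) (C38 j))
      (fun j => KACU P G (f j) (GAY (f j).toKIdx (parA j) (parBY (f j).toKIdx) (GpY (f j).toKIdx (parA j))) (parBY (f j).toKIdx) (C37 j) (C38 j))
      (fun j => pullS (codingYx P G (f j) (C37 j) (C38 j)) (CinvY P f G parA j))
      (fun j => KACU P G (f j) (GAY (f j).toKIdx (parA j) (parBY (f j).toKIdx) (GpY (f j).toKIdx (parA j))) (parBY (f j).toKIdx) (C37 j) (C38 j)) :=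
  stepH2Pos_of_e4h2GFrame₆ (F := (e4h2GFrame₆CodedOn P f c35 G parA (fun j => parBY (f j).toKIdx) b ιB C37 C38 hι hG1 hpar hunit M₂ hM₂ hrepr hcR Cq hCq hC37 MInv aInv aW hMInv haInv haW hunitX hsym hunitA
        (hparB_parBY f G) hb₁ C₀ hC₀ hreg335P hC37G cVar hcVar hvarB hMd mN hnbr).swapGp (fun j => KSC₇Par P G (f j) (parA j) (parH j) (C37 j) (C38 j))
      (fun j _ _ c => eBlock_KSC₇Par_iff P G (f j) (parA j) (parH j) (C37 j) (C38 j) c)) d261 h261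

/-- ★ **THE (3.46) MEMBER OF `KACU` THROUGH THE RE-KEYED G FRAME** ((3.77) in block-`ℓ²` PROVED at `parA` by `read377L2_gFrame₅CodedOn`): `stepL2Pos_of_l2GFrame₈` on
`B9SectBL2GFrameCodedV8YRG.l2GFrame₈CodedOn … (read377L2_gFrame₅CodedOn …)` AT `parA`, re-keyed by `L2GFrame₈.swapGp` (the displayed (3.77) field reads the (3.42) and
(3.46) blocks of the G′ family — both transporter-blind). [cite: Balaban1985BackgroundPropagators, Thm 3.4 p.400, Thm 3.3 p.399, (3.46) p.398, (3.77) p.406, (3.82)–(3.86) p.407; Balaban1984PropagatorsII, Prop. 2.6 (2.140)–(2.141) p.247, Lemma 2.1 p.234] -/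
theorem stepL2Pos_KACU_framePar_on (hι : ∀ (j : J) (s : BlkY (f j).toKIdx), β (f j).toKIdx.hN (f j).toKIdx.D (f j).toKIdx.hk (ιB j s) = s)
    (hG1 : ∀ u : 𝔸ˣ, u ∈ G → ‖(u : 𝔸)‖ ≤ 1) (hpar : ∀ j (U : CfgY 𝔸 (f j).toKIdx), GVal G (f j).toKIdx U → ∀ z w, parA j U z w ∈ G)
    (hunit : ∀ j (U : CfgY 𝔸 (f j).toKIdx), GVal G (f j).toKIdx U → IsUnit (deltaPrimeAY (f j).toKIdx (parA j) U))
    (M₂ : ℝ) (hM₂ : 0 ≤ M₂) (hrepr : ∀ (v : 𝔸) (j : ι), |b.repr v j| ≤ M₂ * ‖v‖) (hcR : 0 < M₂ * ∑ j, ‖b j‖)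
    (Cq : ℝ) (hCq : 0 ≤ Cq) (hC37 : ∀ j β' U a, C37 j β' U a → GVal G (f j).toKIdx U ∧ CplxLettersY G (f j) (parA j) (ιB j) Cq β' U a)
    (MInv aInv aW : ℝ) (hMInv : 0 < MInv) (haInv : 0 < aInv) (haW : 0 < aW)
    (hunitX : ∀ j (U : CfgY 𝔸 (f j).toKIdx), GVal G (f j).toKIdx U → IsUnit (XY (f j).toKIdx (parA j) (GpY (f j).toKIdx (parA j)) U))
    (hsym : ∀ j (U : CfgY 𝔸 (f j).toKIdx) (z w : SiteY (f j).toKIdx), parA j U z w = (parA j U w z)⁻¹)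
    (hunitA : ∀ j (α₀ : ℝ) (U : CfgY 𝔸 (f j).toKIdx), MInv ≤ (geo9Y (f j)).M → 0 < α₀ → (geo9Y (f j)).M * α₀ ≤ aInv →
      (bg9YC 𝔸 G P (f j)).Reg335 c35 α₀ U →
      IsUnit (deltaAY (f j).toKIdx (parA j) (parBY (f j).toKIdx) (GpY (f j).toKIdx (parA j)) U)) (hb₁ : 0 ≤ b₁)
    (C₀ : ℝ) (hC₀ : 0 ≤ C₀)
    (hreg335P : ∀ j (α₀ : ℝ) (U : CfgY 𝔸 (f j).toKIdx), MInv ≤ (geo9Y (f j)).M → 0 < α₀ → (geo9Y (f j)).M * α₀ ≤ aInv →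
      (bg9YC 𝔸 G P (f j)).Reg335 c35 α₀ U → Reg335PlaqY G (f j) (ιB j) C₀ U)
    (hC37G : ∀ j β' U a, C37 j β' U a → CplxLettersGY G (f j) (ιB j) β' U a)
    (cVar : ℝ) (hcVar : 0 ≤ cVar) (hvarB : ∀ j β' U a, C37 j β' U a → VarParBY (f j).toKIdx (parBY (f j).toKIdx) cVar β' U a)
    (hMd : 2 * ((d : ℝ) + 1) < MInv) (mN : ℕ) (hnbr : ∀ (j : J) (y' : IBondY (f j).toKIdx), (nbr (geo9Y (f j)) (2 * ((d : ℝ) + 1)) y').card ≤ mN)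
    (d261 : ℝ → ℕ)
    (h261 : ∀ (j : J) (δ α : ℝ), 0 < δ → δ ≤ 1 → 9 / 5000 ≤ α → α < 1 →
      (gFrame₅CodedOn P f c35 G parA (fun j => parBY (f j).toKIdx) b ιB C37 C38 hι hG1 hpar hunit M₂ hM₂ hrepr hcR Cq hCq hC37 MInv aInv aW hMInv haInv haW
        hunitX hsym hunitA (hparB_parBY f G) hb₁ C₀ hC₀ hreg335P hC37G cVar hcVar hvarB hMd mN hnbr).M261 δ ≤ (geo9Y (f j)).M →
      Ineq261 (d261 δ) (toB6 (geo9Y (f j)) 0 True) δ α) :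
    StepL2Pos (d + 1) c35 (fun j => geo9Y (f j)) (fun j => (codingYx P G (f j) (C37 j) (C38 j)).bg) (fun j => KSC₇Par P G (f j) (parA j) (parH j) (C37 j) (C38 j))
      (fun j => KACU P G (f j) (GAY (f j).toKIdx (parA j) (parBY (f j).toKIdx) (GpY (f j).toKIdx (parA j))) (parBY (f j).toKIdx) (C37 j) (C38 j))
      (fun j => pullS (codingYx P G (f j) (C37 j) (C38 j)) (CinvY P f G parA j))
      (fun j => KACU P G (f j) (GAY (f j).toKIdx (parA j) (parBY (f j).toKIdx) (GpY (f j).toKIdx (parA j))) (parBY (f j).toKIdx) (C37 j) (C38 j)) :=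
  stepL2Pos_of_l2GFrame₈ (F := (l2GFrame₈CodedOn P f c35 G parA (fun j => parBY (f j).toKIdx) b ιB C37 C38 hι hG1 hpar hunit M₂ hM₂ hrepr hcR Cq hCq hC37 MInv aInv aW hMInv haInv haW hunitX hsym hunitA
        (hparB_parBY f G) hb₁ C₀ hC₀ hreg335P hC37G cVar hcVar hvarB hMd mN hnbr
        (read377L2_gFrame₅CodedOn P f c35 G parA (fun j => parBY (f j).toKIdx) b ιB C37 C38 hι hG1 hpar hunit M₂ hM₂ hrepr hcR Cq hCq hC37 MInv aInv aW hMInv haInv haW hunitX hsym hunitA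
        (hparB_parBY f G) hb₁ C₀ hC₀ hreg335P hC37G cVar hcVar hvarB hMd mN hnbr)).swapGp (fun j => KSC₇Par P G (f j) (parA j) (parH j) (C37 j) (C38 j))
      (fun j _ _ c => eBlock_KSC₇Par_iff P G (f j) (parA j) (parH j) (C37 j) (C38 j) c)
      (fun j _ _ c => l2Block_KSC₇Par_iff P G (f j) (parA j) (parH j) (C37 j) (C38 j) c)) d261 h261

end GSide

/-! ## §2 ★★★ `SectBStepUPar` assembled from the sixteen members -/

section Assembly

/-- ★★★ **THE ROW-13 STEP OF RECORD WITH THE TWO TRANSPORTER ROLES SEPARATED — `SectBStepUPar P f (d+1) c35 G b parA parH (GAY … parA parBY (GpY parA)) parBY C37 C38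
(CinvY P f G parA)` PROVED on a subfamily `f` with sections `ιB`**: print's Sect. B step («Thus Theorem 3.4 is proved, assuming that Theorems 3.1–3.3 hold», p.407) in
U-letters over dag-n06-c's coded carrier, for the two-transporter site-sector reading `KSCUPar parA parH` (averaging contours (3.21) in `G′ = GpY parA`, Hölder contours
(3.40) in the (3.43)∕(3.45) quotients transported by `parH`), the bond reading `KACU (GAY parA parBY (GpY parA)) parBY`, the (3.48) kernel `CinvY … parA` and the
analyticity pin `IsAnKY parA`; ASSEMBLED by `B9SectBStepWhole.sectBStepPrinted_of_posBlockSteps` from the eight G′ members of this road (`stepEPos ∕ stepGlobPos ∕ stepE4Pos ∕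
stepKerPos ∕ stepAnalyticPos_KSCUPar_on`, `stepL2Pos_KSCUPar_on`, `stepH1Pos_KSCUPar_on`, `stepH2Pos_KSCUPar_on`) and §1's six G members.  DISPLAYED — structural:
`hι hG1 b M₂ hrepr hcR hcL MInv aInv aW hMd hMr mN hnbr hb₁ C₀ hreg335P hC37 hC37G cVar hvarB cP hplaq (d261, h261)` (as `B9SectBStepUGuardedR.sectBStepU_of_members_g`,
all GUARDED where the record guards them); the AVERAGING-transporter laws AT `parA`: `hpar` (values in `G`), `hunit` (`Δ′_a(U)` a unit), `hunitX` (`(Q′G′²Q′*)(U)` a unit),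
`hsym` (reversal), `hunitA` (`Δ_a(U)` a unit on the class, GUARDED — Thm 3.1∕3.11's regime); the HÖLDER-transporter laws AT `parH`: `hparH` (values in `G`), `hLip`
(`Reg335 ⇒ HolderLipY c_Lip (parH U) U`); the record's Theorem 3.2 `h32` for `C = CY parA (GpY parA)`; Theorem 3.3 `h33` READ OVER THE CODED CARRIERS for `(KSCUPar parA
parH, KACU)` (from the record-level Theorem 3.3 for `(kernelFamilyS … (GpY parA) parH, kernelFamilyB … OA parBY)` by dag-n06-d's `B9LeafXCodedKnitUParH.thm33Printed_codedUPar`).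
[cite: Balaban1985BackgroundPropagators, Thm 3.4 p.400, Sect. B (3.50)–(3.86) pp.400–407, p.403 l.1–9, p.407, Thms 3.1–3.3 (3.42)–(3.48) pp.397–399, (3.21) p.394, (3.40) p.397, (3.35)–(3.37) p.396, (3.77) p.406; Balaban1984PropagatorsII, Lemma 2.1 p.234, (2.45) p.231, (2.51) p.232] -/
theorem sectBStepUPar_of_members (hι : ∀ (j : J) (s : BlkY (f j).toKIdx), β (f j).toKIdx.hN (f j).toKIdx.D (f j).toKIdx.hk (ιB j s) = s)
    (hG1 : ∀ u : 𝔸ˣ, u ∈ G → ‖(u : 𝔸)‖ ≤ 1)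
    (hpar : ∀ j (U : CfgY 𝔸 (f j).toKIdx), GVal G (f j).toKIdx U → ∀ z w, parA j U z w ∈ G)
    (hparH : ∀ j (U : CfgY 𝔸 (f j).toKIdx), GVal G (f j).toKIdx U → ∀ z w, parH j U z w ∈ G)
    (hunit : ∀ j (U : CfgY 𝔸 (f j).toKIdx), GVal G (f j).toKIdx U → IsUnit (deltaPrimeAY (f j).toKIdx (parA j) U))
    (M₂ : ℝ) (hM₂ : 0 ≤ M₂) (hrepr : ∀ (v : 𝔸) (j : ι), |b.repr v j| ≤ M₂ * ‖v‖) (hcR : 0 < M₂ * ∑ j, ‖b j‖)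
    (hcL : 0 < Real.sqrt (Fintype.card ι) * M₂ * ∑ j, ‖b j‖)
    (Cq : ℝ) (hCq : 0 ≤ Cq)
    (hC37 : ∀ j β' U a, C37 j β' U a → GVal G (f j).toKIdx U ∧ CplxLettersY G (f j) (parA j) (ιB j) Cq β' U a)
    (MInv aInv aW : ℝ) (hMInv : 0 < MInv) (haInv : 0 < aInv) (haW : 0 < aW)
    (hunitX : ∀ j (U : CfgY 𝔸 (f j).toKIdx), GVal G (f j).toKIdx U → IsUnit (XY (f j).toKIdx (parA j) (GpY (f j).toKIdx (parA j)) U))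
    (hsym : ∀ j (U : CfgY 𝔸 (f j).toKIdx) (z w : SiteY (f j).toKIdx), parA j U z w = (parA j U w z)⁻¹)
    (hunitA : ∀ j (α₀ : ℝ) (U : CfgY 𝔸 (f j).toKIdx), MInv ≤ (geo9Y (f j)).M → 0 < α₀ → (geo9Y (f j)).M * α₀ ≤ aInv →
      (bg9YC 𝔸 G P (f j)).Reg335 c35 α₀ U → IsUnit (deltaAY (f j).toKIdx (parA j) (parBY (f j).toKIdx) (GpY (f j).toKIdx (parA j)) U)) (hb₁ : 0 ≤ b₁)
    (C₀ : ℝ) (hC₀ : 0 ≤ C₀)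
    (hreg335P : ∀ j (α₀ : ℝ) (U : CfgY 𝔸 (f j).toKIdx), MInv ≤ (geo9Y (f j)).M → 0 < α₀ → (geo9Y (f j)).M * α₀ ≤ aInv →
      (bg9YC 𝔸 G P (f j)).Reg335 c35 α₀ U → Reg335PlaqY G (f j) (ιB j) C₀ U)
    (hC37G : ∀ j β' U a, C37 j β' U a → CplxLettersGY G (f j) (ιB j) β' U a)
    (cVar : ℝ) (hcVar : 0 ≤ cVar) (hvarB : ∀ j β' U a, C37 j β' U a → VarParBY (f j).toKIdx (parBY (f j).toKIdx) cVar β' U a)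
    (hMd : 2 * ((d : ℝ) + 1) < MInv) (mN : ℕ) (hnbr : ∀ (j : J) (y' : IBondY (f j).toKIdx), (nbr (geo9Y (f j)) (2 * ((d : ℝ) + 1)) y').card ≤ mN)
    (hMr : rLB d ℓ + 1 < MInv)
    {cLip : ℝ} (hcLip : 0 ≤ cLip)
    (hLip : ∀ (j : J) (α₀ : ℝ) (U : CfgY 𝔸 (f j).toKIdx), (bg9YC 𝔸 G P (f j)).Reg335 c35 α₀ U → HolderLipY (f j).toKIdx cLip (parH j U) U)
    {cP : ℝ} (hcP : 0 ≤ cP)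
    (hplaq : ∀ (j : J) (α₀ : ℝ) (U : CfgY 𝔸 (f j).toKIdx), MInv ≤ (geo9Y (f j)).M → 0 < α₀ → (geo9Y (f j)).M * α₀ ≤ aInv →
      (bg9YC 𝔸 G P (f j)).Reg335 c35 α₀ U → PlaqLawY (f j) (ιB j) cP U)
    (d261 : ℝ → ℕ)
    (h261 : ∀ (j : J) (δ α : ℝ), 0 < δ → δ ≤ 1 → 9 / 5000 ≤ α → α < 1 →
      (gFrame₅CodedOn P f c35 G parA (fun j => parBY (f j).toKIdx) b ιB C37 C38 hι hG1 hpar hunit M₂ hM₂ hrepr hcR Cq hCq hC37 MInv aInv aW hMInv haInv haW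
        hunitX hsym hunitA (hparB_parBY f G) hb₁ C₀ hC₀ hreg335P hC37G cVar hcVar hvarB hMd mN hnbr).M261 δ ≤ (geo9Y (f j)).M →
      Ineq261 (d261 δ) (toB6 (geo9Y (f j)) 0 True) δ α)
    (h32 : B9.Thm32Printed (d + 1) c35 (fun j => geo9Y (f j)) (fun j => bg9YC 𝔸 G P (f j)) (CinvY P f G parA))
    (h33 : B9.Thm33Printed c35 (fun j => geo9Y (f j)) (fun j => (codingYx P G (f j) (C37 j) (C38 j)).bg)
      (fun j => KSCUPar P G (f j) (parA j) (parH j) (C37 j) (C38 j))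
      (fun j => KACU P G (f j) (GAY (f j).toKIdx (parA j) (parBY (f j).toKIdx) (GpY (f j).toKIdx (parA j))) (parBY (f j).toKIdx) (C37 j) (C38 j))) :
    SectBStepUPar P f (d + 1) c35 G b parA parH (fun j => GAY (f j).toKIdx (parA j) (parBY (f j).toKIdx) (GpY (f j).toKIdx (parA j))) (fun j => parBY (f j).toKIdx)
      C37 C38 (CinvY P f G parA) := by
  -- the G side: §1's six re-keyed frame steps (G′-input `KSC₇Par`), moved to the `KSCUPar` input slot
  have hEa := stepPos_KSCUPar_of_KSC₇Par P f c35 G b ιB C38 parA parH C37 (fun j => GAY (f j).toKIdx (parA j) (parBY (f j).toKIdx) (GpY (f j).toKIdx (parA j))) (fun j => parBY (f j).toKIdx)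
    (CinvY P f G parA) hι hG1 hM₂ hrepr (d + 1)
    (stepEPos_KACU_framePar_on P f c35 G b ιB C38 parA parH C37 hι hG1 hpar hunit M₂ hM₂ hrepr hcR Cq hCq hC37 MInv aInv aW hMInv haInv haW hunitX hsym hunitA hb₁ C₀ hC₀ hreg335P hC37G cVar hcVar hvarB hMd mN hnbr
      d261 h261)
  have hGa := stepPos_KSCUPar_of_KSC₇Par P f c35 G b ιB C38 parA parH C37 (fun j => GAY (f j).toKIdx (parA j) (parBY (f j).toKIdx) (GpY (f j).toKIdx (parA j))) (fun j => parBY (f j).toKIdx)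
    (CinvY P f G parA) hι hG1 hM₂ hrepr (d + 1)
    (stepGlobPos_KACU_framePar_on P f c35 G b ιB C38 parA parH C37 hι hG1 hpar hunit M₂ hM₂ hrepr hcR Cq hCq hC37 MInv aInv aW hMInv haInv haW hunitX hsym hunitA hb₁ C₀ hC₀ hreg335P hC37G cVar hcVar hvarB hMd mN hnbr
      d261 h261)
  have hH1a := stepPos_KSCUPar_of_KSC₇Par P f c35 G b ιB C38 parA parH C37 (fun j => GAY (f j).toKIdx (parA j) (parBY (f j).toKIdx) (GpY (f j).toKIdx (parA j))) (fun j => parBY (f j).toKIdx)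
    (CinvY P f G parA) hι hG1 hM₂ hrepr (d + 1)
    (stepH1Pos_KACU_framePar_on P f c35 G b ιB C38 parA parH C37 hι hG1 hpar hunit M₂ hM₂ hrepr hcR Cq hCq hC37 MInv aInv aW hMInv haInv haW hunitX hsym hunitA hb₁ C₀ hC₀ hreg335P hC37G cVar hcVar hvarB hMd mN hnbr
      hMr d261 h261)
  have hE4a := stepPos_KSCUPar_of_KSC₇Par P f c35 G b ιB C38 parA parH C37 (fun j => GAY (f j).toKIdx (parA j) (parBY (f j).toKIdx) (GpY (f j).toKIdx (parA j))) (fun j => parBY (f j).toKIdx)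
    (CinvY P f G parA) hι hG1 hM₂ hrepr (d + 1)
    (stepE4Pos_KACU_framePar_on P f c35 G b ιB C38 parA parH C37 hι hG1 hpar hunit M₂ hM₂ hrepr hcR Cq hCq hC37 MInv aInv aW hMInv haInv haW hunitX hsym hunitA hb₁ C₀ hC₀ hreg335P hC37G cVar hcVar hvarB hMd mN hnbr
      d261 h261)
  have hH2a := stepPos_KSCUPar_of_KSC₇Par P f c35 G b ιB C38 parA parH C37 (fun j => GAY (f j).toKIdx (parA j) (parBY (f j).toKIdx) (GpY (f j).toKIdx (parA j))) (fun j => parBY (f j).toKIdx)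
    (CinvY P f G parA) hι hG1 hM₂ hrepr (d + 1)
    (stepH2Pos_KACU_framePar_on P f c35 G b ιB C38 parA parH C37 hι hG1 hpar hunit M₂ hM₂ hrepr hcR Cq hCq hC37 MInv aInv aW hMInv haInv haW hunitX hsym hunitA hb₁ C₀ hC₀ hreg335P hC37G cVar hcVar hvarB hMd mN hnbr
      d261 h261)
  have hLa := stepPos_KSCUPar_of_KSC₇Par P f c35 G b ιB C38 parA parH C37 (fun j => GAY (f j).toKIdx (parA j) (parBY (f j).toKIdx) (GpY (f j).toKIdx (parA j))) (fun j => parBY (f j).toKIdx)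
    (CinvY P f G parA) hι hG1 hM₂ hrepr (d + 1)
    (stepL2Pos_KACU_framePar_on P f c35 G b ιB C38 parA parH C37 hι hG1 hpar hunit M₂ hM₂ hrepr hcR Cq hCq hC37 MInv aInv aW hMInv haInv haW hunitX hsym hunitA hb₁ C₀ hC₀ hreg335P hC37G cVar hcVar hvarB hMd mN hnbr
      d261 h261)
  -- the G′ side: the eight members of the two-transporter reading `KSCUPar parA parH`
  exact sectBStepPrinted_of_posBlockSteps (fun j => modelSignsOn_geo9K (f j).toKIdx)
    (thm32Printed_codedU P f c35 G C38 C37 _ (d + 1) h32) h33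
    (stepAnalyticPos_KSCUPar_on P f c35 G parA parH (fun j => GAY (f j).toKIdx (parA j) (parBY (f j).toKIdx) (GpY (f j).toKIdx (parA j)))
      (fun j => parBY (f j).toKIdx) b ιB C37 C38 _ hι hG1 hpar hunit (d + 1) M₂ hM₂ hrepr hcR Cq hCq hC37 MInv aInv aW hMInv haInv haW)
    (stepEPos_KSCUPar_on P f c35 G parA parH (fun j => GAY (f j).toKIdx (parA j) (parBY (f j).toKIdx) (GpY (f j).toKIdx (parA j)))
      (fun j => parBY (f j).toKIdx) b ιB C37 C38 _ hι hG1 hpar hunit (d + 1) M₂ hM₂ hrepr hcR Cq hCq hC37 MInv aInv aW hMInv haInv haW)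
    (stepL2Pos_KSCUPar_on P f c35 G b C37 C38 parA parH (fun j => GAY (f j).toKIdx (parA j) (parBY (f j).toKIdx) (GpY (f j).toKIdx (parA j)))
      (fun j => parBY (f j).toKIdx) ιB _ hι hG1 hpar hunit (d + 1) M₂ hM₂ hrepr hcR hcL Cq hCq hC37 MInv aInv aW hMInv haInv haW hcP hplaq)
    (stepGlobPos_KSCUPar_on P f c35 G parA parH (fun j => GAY (f j).toKIdx (parA j) (parBY (f j).toKIdx) (GpY (f j).toKIdx (parA j)))
      (fun j => parBY (f j).toKIdx) b ιB C37 C38 _ hι hG1 hpar hunit (d + 1) M₂ hM₂ hrepr hcR Cq hCq hC37 MInv aInv aW hMInv haInv haW)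
    (stepH1Pos_KSCUPar_on P f c35 G parA parH (fun j => GAY (f j).toKIdx (parA j) (parBY (f j).toKIdx) (GpY (f j).toKIdx (parA j)))
      (fun j => parBY (f j).toKIdx) b ιB C37 C38 _ hι hG1 hpar hparH hunit (d + 1) M₂ hM₂ hrepr hcR Cq hCq hC37 MInv aInv aW hMInv haInv haW
      hcLip hLip)
    (stepE4Pos_KSCUPar_on P f c35 G parA parH (fun j => GAY (f j).toKIdx (parA j) (parBY (f j).toKIdx) (GpY (f j).toKIdx (parA j)))
      (fun j => parBY (f j).toKIdx) b ιB C37 C38 _ hι hG1 hpar hunit (d + 1) M₂ hM₂ hrepr hcR Cq hCq hC37 MInv aInv aW hMInv haInv haW)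
    (stepH2Pos_KSCUPar_on P f c35 G parA parH (fun j => GAY (f j).toKIdx (parA j) (parBY (f j).toKIdx) (GpY (f j).toKIdx (parA j)))
      (fun j => parBY (f j).toKIdx) b ιB C37 C38 _ hι hG1 hpar hunit (d + 1) M₂ hM₂ hrepr hcR Cq hCq hC37 MInv aInv aW hMInv haInv haW)
    (stepKerPos_KSCUPar_on P f c35 G parA parH (fun j => GAY (f j).toKIdx (parA j) (parBY (f j).toKIdx) (GpY (f j).toKIdx (parA j)))
      (fun j => parBY (f j).toKIdx) b ιB C37 C38 hι hG1 hpar hunit M₂ hM₂ hrepr hcR Cq hCq hC37 MInv aInv aW hMInv haInv haW hunitX hsym)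
    hEa hLa hGa hH1a hE4a hH2a

/-- ★★ **THEOREM 3.4 OF RECORD WITH THE TWO TRANSPORTERS, `Thm34UPar`, on the subfamily** — «Thus Theorem 3.4 is proved, assuming that Theorems 3.1–3.3 hold» (p.407):
`B9.thm34_of_sectB` on `sectBStepUPar_of_members` and the Theorems 3.2 ∕ 3.3 over the coded carrier; same binders.
[cite: Balaban1985BackgroundPropagators, Thm 3.4 p.400, Sect. B p.407, Thms 3.2–3.3 pp.398–399] -/
theorem thm34UPar_of_members (hι : ∀ (j : J) (s : BlkY (f j).toKIdx), β (f j).toKIdx.hN (f j).toKIdx.D (f j).toKIdx.hk (ιB j s) = s)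
    (hG1 : ∀ u : 𝔸ˣ, u ∈ G → ‖(u : 𝔸)‖ ≤ 1)
    (hpar : ∀ j (U : CfgY 𝔸 (f j).toKIdx), GVal G (f j).toKIdx U → ∀ z w, parA j U z w ∈ G)
    (hparH : ∀ j (U : CfgY 𝔸 (f j).toKIdx), GVal G (f j).toKIdx U → ∀ z w, parH j U z w ∈ G)
    (hunit : ∀ j (U : CfgY 𝔸 (f j).toKIdx), GVal G (f j).toKIdx U → IsUnit (deltaPrimeAY (f j).toKIdx (parA j) U))
    (M₂ : ℝ) (hM₂ : 0 ≤ M₂) (hrepr : ∀ (v : 𝔸) (j : ι), |b.repr v j| ≤ M₂ * ‖v‖) (hcR : 0 < M₂ * ∑ j, ‖b j‖)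
    (hcL : 0 < Real.sqrt (Fintype.card ι) * M₂ * ∑ j, ‖b j‖)
    (Cq : ℝ) (hCq : 0 ≤ Cq)
    (hC37 : ∀ j β' U a, C37 j β' U a → GVal G (f j).toKIdx U ∧ CplxLettersY G (f j) (parA j) (ιB j) Cq β' U a)
    (MInv aInv aW : ℝ) (hMInv : 0 < MInv) (haInv : 0 < aInv) (haW : 0 < aW)
    (hunitX : ∀ j (U : CfgY 𝔸 (f j).toKIdx), GVal G (f j).toKIdx U → IsUnit (XY (f j).toKIdx (parA j) (GpY (f j).toKIdx (parA j)) U))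
    (hsym : ∀ j (U : CfgY 𝔸 (f j).toKIdx) (z w : SiteY (f j).toKIdx), parA j U z w = (parA j U w z)⁻¹)
    (hunitA : ∀ j (α₀ : ℝ) (U : CfgY 𝔸 (f j).toKIdx), MInv ≤ (geo9Y (f j)).M → 0 < α₀ → (geo9Y (f j)).M * α₀ ≤ aInv →
      (bg9YC 𝔸 G P (f j)).Reg335 c35 α₀ U → IsUnit (deltaAY (f j).toKIdx (parA j) (parBY (f j).toKIdx) (GpY (f j).toKIdx (parA j)) U)) (hb₁ : 0 ≤ b₁)
    (C₀ : ℝ) (hC₀ : 0 ≤ C₀)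
    (hreg335P : ∀ j (α₀ : ℝ) (U : CfgY 𝔸 (f j).toKIdx), MInv ≤ (geo9Y (f j)).M → 0 < α₀ → (geo9Y (f j)).M * α₀ ≤ aInv →
      (bg9YC 𝔸 G P (f j)).Reg335 c35 α₀ U → Reg335PlaqY G (f j) (ιB j) C₀ U)
    (hC37G : ∀ j β' U a, C37 j β' U a → CplxLettersGY G (f j) (ιB j) β' U a)
    (cVar : ℝ) (hcVar : 0 ≤ cVar) (hvarB : ∀ j β' U a, C37 j β' U a → VarParBY (f j).toKIdx (parBY (f j).toKIdx) cVar β' U a)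
    (hMd : 2 * ((d : ℝ) + 1) < MInv) (mN : ℕ) (hnbr : ∀ (j : J) (y' : IBondY (f j).toKIdx), (nbr (geo9Y (f j)) (2 * ((d : ℝ) + 1)) y').card ≤ mN)
    (hMr : rLB d ℓ + 1 < MInv)
    {cLip : ℝ} (hcLip : 0 ≤ cLip)
    (hLip : ∀ (j : J) (α₀ : ℝ) (U : CfgY 𝔸 (f j).toKIdx), (bg9YC 𝔸 G P (f j)).Reg335 c35 α₀ U → HolderLipY (f j).toKIdx cLip (parH j U) U)
    {cP : ℝ} (hcP : 0 ≤ cP)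
    (hplaq : ∀ (j : J) (α₀ : ℝ) (U : CfgY 𝔸 (f j).toKIdx), MInv ≤ (geo9Y (f j)).M → 0 < α₀ → (geo9Y (f j)).M * α₀ ≤ aInv →
      (bg9YC 𝔸 G P (f j)).Reg335 c35 α₀ U → PlaqLawY (f j) (ιB j) cP U)
    (d261 : ℝ → ℕ)
    (h261 : ∀ (j : J) (δ α : ℝ), 0 < δ → δ ≤ 1 → 9 / 5000 ≤ α → α < 1 →
      (gFrame₅CodedOn P f c35 G parA (fun j => parBY (f j).toKIdx) b ιB C37 C38 hι hG1 hpar hunit M₂ hM₂ hrepr hcR Cq hCq hC37 MInv aInv aW hMInv haInv haW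
        hunitX hsym hunitA (hparB_parBY f G) hb₁ C₀ hC₀ hreg335P hC37G cVar hcVar hvarB hMd mN hnbr).M261 δ ≤ (geo9Y (f j)).M →
      Ineq261 (d261 δ) (toB6 (geo9Y (f j)) 0 True) δ α)
    (h32 : B9.Thm32Printed (d + 1) c35 (fun j => geo9Y (f j)) (fun j => bg9YC 𝔸 G P (f j)) (CinvY P f G parA))
    (h33 : B9.Thm33Printed c35 (fun j => geo9Y (f j)) (fun j => (codingYx P G (f j) (C37 j) (C38 j)).bg)
      (fun j => KSCUPar P G (f j) (parA j) (parH j) (C37 j) (C38 j))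
      (fun j => KACU P G (f j) (GAY (f j).toKIdx (parA j) (parBY (f j).toKIdx) (GpY (f j).toKIdx (parA j))) (parBY (f j).toKIdx) (C37 j) (C38 j))) :
    Thm34UPar P f c35 G b parA parH (fun j => GAY (f j).toKIdx (parA j) (parBY (f j).toKIdx) (GpY (f j).toKIdx (parA j))) (fun j => parBY (f j).toKIdx) C37 C38 :=
  B9.thm34_of_sectB (d + 1) c35 (fun j => geo9Y (f j)) (fun j => (codingYx P G (f j) (C37 j) (C38 j)).bg)
    (fun j => KSCUPar P G (f j) (parA j) (parH j) (C37 j) (C38 j))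
    (fun j => KACU P G (f j) (GAY (f j).toKIdx (parA j) (parBY (f j).toKIdx) (GpY (f j).toKIdx (parA j))) (parBY (f j).toKIdx) (C37 j) (C38 j))
    (fun j => pullS (codingYx P G (f j) (C37 j) (C38 j)) (CinvY P f G parA j)) (fun j => IsAnKY P G (f j) (parA j) b (C37 j) (C38 j))
    (sectBStepUPar_of_members P f c35 G b ιB C38 parA parH C37 hι hG1 hpar hparH hunit M₂ hM₂ hrepr hcR hcL Cq hCq hC37 MInv aInv aW hMInv haInv haW hunitX hsym hunitA
      hb₁ C₀ hC₀ hreg335P hC37G cVar hcVar hvarB hMd mN hnbr hMr hcLip hLip hcP hplaq d261 h261 h32 h33)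
    (thm32Printed_codedU P f c35 G C38 C37 _ (d + 1) h32) h33

end Assembly

/-! ## §3 The Hölder transporter of record `parH := parSymY`: its two laws discharged -/

section HolderOfRecord

/-- ★★★ **`SectBStepUPar` AT THE HÖLDER TRANSPORTER OF RECORD `parH := parSymY` (print's shortest contours), its two laws DISCHARGED** (`hparH := Node00.parSymY_mem`,
`hLip := hLip_parSymY`, `c_Lip = d+1`): `sectBStepUPar_of_members` at `parH j := parSymY (f j).toKIdx`.  The AVERAGING transporter `parA` and its five laws `hpar hunit hunitX
hsym hunitA` stay displayed — the shape of dag-n06-d's displayed binder `hBK` at the knit instance `(parA, parH) := (parKnitY, parSymY)` (the parA-laws there are dag-n06-l's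
K2 lemmas `symm0_parKnitY ∕ isUnit_deltaPrimeAY_parKnitY ∕ …`). [cite: Balaban1985BackgroundPropagators, Thm 3.4 p.400, Sect. B pp.400–407, (3.21) p.394, (3.40) p.397 («a shortest contour»), Thms 3.1–3.3 pp.397–399; Balaban1984PropagatorsII, Lemma 2.1 p.234, (2.51) p.232] -/
theorem sectBStepUPar_parSymYH_of_members (hι : ∀ (j : J) (s : BlkY (f j).toKIdx), β (f j).toKIdx.hN (f j).toKIdx.D (f j).toKIdx.hk (ιB j s) = s)
    (hG1 : ∀ u : 𝔸ˣ, u ∈ G → ‖(u : 𝔸)‖ ≤ 1)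
    (hpar : ∀ j (U : CfgY 𝔸 (f j).toKIdx), GVal G (f j).toKIdx U → ∀ z w, parA j U z w ∈ G)
    (hunit : ∀ j (U : CfgY 𝔸 (f j).toKIdx), GVal G (f j).toKIdx U → IsUnit (deltaPrimeAY (f j).toKIdx (parA j) U))
    (M₂ : ℝ) (hM₂ : 0 ≤ M₂) (hrepr : ∀ (v : 𝔸) (j : ι), |b.repr v j| ≤ M₂ * ‖v‖) (hcR : 0 < M₂ * ∑ j, ‖b j‖)
    (hcL : 0 < Real.sqrt (Fintype.card ι) * M₂ * ∑ j, ‖b j‖)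
    (Cq : ℝ) (hCq : 0 ≤ Cq)
    (hC37 : ∀ j β' U a, C37 j β' U a → GVal G (f j).toKIdx U ∧ CplxLettersY G (f j) (parA j) (ιB j) Cq β' U a)
    (MInv aInv aW : ℝ) (hMInv : 0 < MInv) (haInv : 0 < aInv) (haW : 0 < aW)
    (hunitX : ∀ j (U : CfgY 𝔸 (f j).toKIdx), GVal G (f j).toKIdx U → IsUnit (XY (f j).toKIdx (parA j) (GpY (f j).toKIdx (parA j)) U))
    (hsym : ∀ j (U : CfgY 𝔸 (f j).toKIdx) (z w : SiteY (f j).toKIdx), parA j U z w = (parA j U w z)⁻¹)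
    (hunitA : ∀ j (α₀ : ℝ) (U : CfgY 𝔸 (f j).toKIdx), MInv ≤ (geo9Y (f j)).M → 0 < α₀ → (geo9Y (f j)).M * α₀ ≤ aInv →
      (bg9YC 𝔸 G P (f j)).Reg335 c35 α₀ U → IsUnit (deltaAY (f j).toKIdx (parA j) (parBY (f j).toKIdx) (GpY (f j).toKIdx (parA j)) U)) (hb₁ : 0 ≤ b₁)
    (C₀ : ℝ) (hC₀ : 0 ≤ C₀)
    (hreg335P : ∀ j (α₀ : ℝ) (U : CfgY 𝔸 (f j).toKIdx), MInv ≤ (geo9Y (f j)).M → 0 < α₀ → (geo9Y (f j)).M * α₀ ≤ aInv →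
      (bg9YC 𝔸 G P (f j)).Reg335 c35 α₀ U → Reg335PlaqY G (f j) (ιB j) C₀ U)
    (hC37G : ∀ j β' U a, C37 j β' U a → CplxLettersGY G (f j) (ιB j) β' U a)
    (cVar : ℝ) (hcVar : 0 ≤ cVar) (hvarB : ∀ j β' U a, C37 j β' U a → VarParBY (f j).toKIdx (parBY (f j).toKIdx) cVar β' U a)
    (hMd : 2 * ((d : ℝ) + 1) < MInv) (mN : ℕ) (hnbr : ∀ (j : J) (y' : IBondY (f j).toKIdx), (nbr (geo9Y (f j)) (2 * ((d : ℝ) + 1)) y').card ≤ mN)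
    (hMr : rLB d ℓ + 1 < MInv) {cP : ℝ} (hcP : 0 ≤ cP)
    (hplaq : ∀ (j : J) (α₀ : ℝ) (U : CfgY 𝔸 (f j).toKIdx), MInv ≤ (geo9Y (f j)).M → 0 < α₀ → (geo9Y (f j)).M * α₀ ≤ aInv →
      (bg9YC 𝔸 G P (f j)).Reg335 c35 α₀ U → PlaqLawY (f j) (ιB j) cP U)
    (d261 : ℝ → ℕ)
    (h261 : ∀ (j : J) (δ α : ℝ), 0 < δ → δ ≤ 1 → 9 / 5000 ≤ α → α < 1 →
      (gFrame₅CodedOn P f c35 G parA (fun j => parBY (f j).toKIdx) b ιB C37 C38 hι hG1 hpar hunit M₂ hM₂ hrepr hcR Cq hCq hC37 MInv aInv aW hMInv haInv haW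
        hunitX hsym hunitA (hparB_parBY f G) hb₁ C₀ hC₀ hreg335P hC37G cVar hcVar hvarB hMd mN hnbr).M261 δ ≤ (geo9Y (f j)).M →
      Ineq261 (d261 δ) (toB6 (geo9Y (f j)) 0 True) δ α)
    (h32 : B9.Thm32Printed (d + 1) c35 (fun j => geo9Y (f j)) (fun j => bg9YC 𝔸 G P (f j)) (CinvY P f G parA))
    (h33 : B9.Thm33Printed c35 (fun j => geo9Y (f j)) (fun j => (codingYx P G (f j) (C37 j) (C38 j)).bg)
      (fun j => KSCUPar P G (f j) (parA j) (parSymY (f j).toKIdx) (C37 j) (C38 j))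
      (fun j => KACU P G (f j) (GAY (f j).toKIdx (parA j) (parBY (f j).toKIdx) (GpY (f j).toKIdx (parA j))) (parBY (f j).toKIdx) (C37 j) (C38 j))) :
    SectBStepUPar P f (d + 1) c35 G b parA (fun j => parSymY (f j).toKIdx) (fun j => GAY (f j).toKIdx (parA j) (parBY (f j).toKIdx) (GpY (f j).toKIdx (parA j)))
      (fun j => parBY (f j).toKIdx) C37 C38 (CinvY P f G parA) :=
  sectBStepUPar_of_members P f c35 G b ιB C38 parA (fun j => parSymY (f j).toKIdx) C37 hι hG1 hpar (fun j _ hU z w => parSymY_mem (f j).toKIdx hU z w) hunit M₂ hM₂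
    hrepr hcR hcL Cq hCq hC37 MInv aInv aW hMInv haInv haW hunitX hsym hunitA hb₁ C₀ hC₀ hreg335P hC37G cVar hcVar hvarB hMd mN hnbr hMr
    (by positivity : (0 : ℝ) ≤ (d : ℝ) + 1) (hLip_parSymY P f c35 G hG1) hcP hplaq d261 h261 h32 h33

end HolderOfRecord

end Literature.MathematicalPhysics.QuantumFieldTheory.Balaban1983to89.B9SectBStepUParHOfMembers

end
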